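import Summits.BirchSwinnertonDyer.BirchSwinnertonDyer.Theorems.KolyvaginDepthDoorKolyvaginDepthSupplyDoorOfLeaves
import Literature.NumberTheory.EllipticCurves.SelmerTorsionRestriction
import HarnessLib

/-!
# Route `KolyvaginDepthDoor`, crux `KolyvaginDepthSupply` (stmt-BirchSwinnertonDyer-21765) —
# the hF-free door WITHOUT A POINT ON THE TWIST: Kolyvagin's eigen-Selmer bound read over `ℚ`

Helper file (`--supports stmt-BirchSwinnertonDyer-21765 --as helper`); it closes nothing and BSD is
not proved by it.

The hF-free door of this route (`…KolyvaginDepthSupplyDoorOfLeaves`, `…DoorOfSystem(Reading)`,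
`…DoorOfPrint`, the 18 rows `…DepthTableRowsOfPrint*`) reads Kolyvagin's minimal-depth descent
(`Literature…KolyvaginDescent.HypothesesDepth`, PROVED) through the TOTAL count
`#Sel(E/K)_p ≤ p^{2ν+1}` and the descent count over the Heegner field `K`
(`rank_and_shaCorank_of_natCard_selmerGroup_baseChange_le`): to pin `corank Ш(E/ℚ)[p^∞] = 0` it
needs `ν + 1` independent points on `E(ℚ)` AND `ν` independent points on the twist `E^{(d_K)}(ℚ)`
(for the rank-2 rows: one rational point of infinite order on `E^{(d_K)}`, a per-row datum the tree
does not hold).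

This file removes the twist point. The descent proves MORE than the total count: each eigen-Selmer
group satisfies `#Sel(E/K)_p^{±} ≤ p^{ν+1}` (`HypothesesDepth.card_eigenSel_le_of_ne_zero`, Kolyvagin
1991 Thm. 2.3, upper half). The new Literature file `SelmerTorsionRestriction` (this seat, PROVED, no
named fact) supplies the finite-level restriction `res : H¹(ℚ, E[p]) → H¹(K, E[p])`, injective for
odd `p` (kernel killed by `[K : ℚ] = 2`, `cor ∘ res`) and carrying `Sel_p(E/ℚ)` into the
`+1`-eigenspace `Sel_p(E/K)^+` (Gross 1991, §5 (5.1)). Hence **`#Sel_p(E/ℚ) ≤ p^{ν+1}`**, and the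
descent count OVER `ℚ` (`#Sel_p(E/ℚ) = p^{rank E(ℚ)} · #E(ℚ)[p] · #Ш(E/ℚ)[p]`, Silverman X.4.2)
read against `ν + 1 ≤ rank E(ℚ)` alone gives `rank E(ℚ) = ν + 1`, `E(ℚ)[p] = 0`, **`Ш(E/ℚ)[p] = 0`**
(not only corank `0`) and `corank_{ℤ_p} Ш(E/ℚ)[p^∞] = 0`; the total count over `K` then bounds the
twist: `rank E^{(d_K)}(ℚ) ≤ ν` — which is exactly the crux's first rank clause
`ν + 1 = rank E(ℚ) > rank E^{(d_K)}(ℚ)`, with NO datum on the twist.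

## Theorems

* `rank_and_sha_of_natCard_selmerGroup_le` — UNCONDITIONAL reading over the ground field: for `E`
  elliptic over a number field `F`, `n > 1`, `#Sel^(n)(E/F) ≤ n^a` and `a ≤ rank E(F)` force
  `rank E(F) = a`, `E(F)[n] = 0`, `Ш(E/F)[n] = 0`, `#Sel^(n)(E/F) = n^a`;
  `shaCorank_eq_zero_of_sha_inf_torsionBy_eq_bot` — `Ш(E/F)[n] = 0`, `p ∣ n` ⟹ `corank Ш[p^∞] = 0`.
* `door_of_hypothesesDepth` — **the abstract twist-free door**: for ANY descent data `S` on
  `H¹(K, E[m])` (`m = p` as naturals — the leaves' index `p` and the crux's index `p^1` both fit)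
  with `S.Sel = Sel(E/K)`, `S.τ = conjAct W c`, `S.p = p`, `K` quadratic, `p` odd: one non-zero class
  `S.c n₁ ≠ 0` of depth `ν₁` and `ν₁ + 1 ≤ rank E(ℚ)` ⟹ `t_p(E) = 0`, `rank E(ℚ) = ν₁ + 1`,
  `rank E^{(d_K)}(ℚ) ≤ ν₁`, `E(ℚ)[p] = 0`, `Ш(E/ℚ)[p] = 0`, `#Sel_p(E/ℚ) = p^{ν₁+1}`;
  `kolyvaginDepthSupply_rankClause_of_hypothesesDepth` — the crux's first rank clause verbatim.
* `shaCorank_eq_zero_of_class_ne_zero_of_rank_le_of_leaves`,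
  `shaCorank_eq_zero_of_two_le_rank_of_class_prime_ne_zero_of_leaves` — the leaves currency
  (`exists_hypothesesDepth_of_leaves`): g5's `shaCorank_eq_zero_of_class_ne_zero_of_points_of_leaves`
  / `…_of_rank_two_…_of_leaves` with the hypothesis `b ≤ rank E^{(d_K)}(ℚ)` / `1 ≤ rank E^{(d_K)}(ℚ)`
  DELETED (conclusion on the twist weakened to `≤`, conclusion on `E` strengthened to `Ш(E/ℚ)[p] = 0`).

Trust base: as `…DoorOfLeaves` (named facts `Gross1991_prop_8_1_one`, `Gross1991_prop_8_2_finset`;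
hypotheses `hcl` on the class family) MINUS the twist point; the restriction/eigenspace input is a
theorem (`SelmerTorsionRestriction`). Per-curve; conditional on the displayed hypotheses; BSD is not
proved by it.

References: [Kolyvagin1991MathAnn] Thm. 2.3; [GrossLMS1991] §5 (5.1), §10; [SilvermanAEC2009]
Thm. X.4.2; [DokchitserDokchitserAnnals2010] Lemma 4.14 (restriction); [SerreGaloisCohomology1997]
I.§2.4 Prop. 9.
-/

set_option linter.dupNamespace false

noncomputable section

open scoped Classical

namespace Summit.BirchSwinnertonDyer.BirchSwinnertonDyer.Theorems.KolyvaginDepthDoor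

open Literature.NumberTheory.EllipticCurves Literature.NumberTheory.EllipticCurves.KolyvaginDescent
  WeierstrassCurve NumberField IsDedekindDomain

/-! ## The descent count read over the ground field (unconditional) -/

/-- **Reading a Selmer count over the ground field against known points.** `E` elliptic over a
number field `F`, `n > 1`, `a ≤ rank E(F)`: if `#Sel^(n)(E/F) ≤ n^a` then `rank E(F) = a`,
`#E(F)[n] = 1`, `Ш(E/F)[n] = 0` (as the subgroup `Ш ⊓ H¹(F,E)[n]`) and `#Sel^(n)(E/F) = n^a` — the
exact descent count `#Sel^(n) = n^{rank} · #E(F)[n] · #Ш[n]` (`natCard_selmerGroup_eq`,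
Silverman X.4.2) pins every factor. Unconditional. [cite: SilvermanAEC2009, Thm X.4.2] -/
theorem rank_and_sha_of_natCard_selmerGroup_le {F : Type*} [Field F] [NumberField F]
    (W : WeierstrassCurve F) [W.IsElliptic] {n : ℕ} (hn : 1 < n) (a : ℕ)
    (hSel : Nat.card ↥(selmerGroup W (n : ℤ)) ≤ n ^ a) (ha : a ≤ W.mordellWeilRank) :
    W.mordellWeilRank = a ∧ Nat.card ↥(AddSubgroup.torsionBy W.toAffine.Point (n : ℤ)) = 1 ∧
      W.sha ⊓ AddSubgroup.torsionBy W.galH1 (n : ℤ) = ⊥ ∧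
      Nat.card ↥(selmerGroup W (n : ℤ)) = n ^ a := by
  have hn0 : n ≠ 0 := by omega
  have hcount := W.natCard_selmerGroup_eq hn0
  set r := W.mordellWeilRank with hr_def
  set t := Nat.card ↥(AddSubgroup.torsionBy W.toAffine.Point (n : ℤ)) with ht_def
  set u := Nat.card ↥(W.sha ⊓ AddSubgroup.torsionBy W.galH1 (n : ℤ)) with hu_def
  haveI hfinSel : Finite ↥(selmerGroup W (n : ℤ)) :=
    W.finite_selmerGroup_holds (by exact_mod_cast hn0)
  have hSelpos : 0 < Nat.card ↥(selmerGroup W (n : ℤ)) := Nat.card_pos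
  rw [hcount] at hSel hSelpos
  have ht0 : 0 < t := Nat.pos_of_ne_zero fun h ↦ by
    rw [h, mul_zero, zero_mul] at hSelpos
    exact lt_irrefl 0 hSelpos
  have hu0 : 0 < u := Nat.pos_of_ne_zero fun h ↦ by
    rw [h, mul_zero] at hSelpos
    exact lt_irrefl 0 hSelpos
  have hpow : n ^ r ≤ n ^ a := by
    calc n ^ r ≤ n ^ r * t * u := by
          rw [mul_assoc]
          exact Nat.le_mul_of_pos_right _ (Nat.mul_pos ht0 hu0)
      _ ≤ n ^ a := hSel
  have hra' : r ≤ a := (Nat.pow_le_pow_iff_right hn).mp hpow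
  have hra : r = a := le_antisymm hra' ha
  rw [hra] at hSel
  have hppos : 0 < n ^ a := Nat.pow_pos (by omega)
  have htu : t * u ≤ 1 := by
    have : n ^ a * (t * u) ≤ n ^ a * 1 := by rw [mul_one, ← mul_assoc]; exact hSel
    exact Nat.le_of_mul_le_mul_left this hppos
  have ht1 : t = 1 := by nlinarith
  have hu1 : u = 1 := by nlinarith
  refine ⟨hra, ht1, AddSubgroup.card_eq_one.mp hu1, ?_⟩
  rw [hcount, hra, ht1, hu1, mul_one, mul_one]

/-- **`Ш(E/F)[n] = 0` with `p ∣ n` gives `corank_{ℤ_p} Ш(E/F)[p^∞] = 0`**: a class of `Ш` killed by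
`p` is killed by `n`, hence trivial; so the `p`-primary part of `Ш` has no `p`-torsion and corank `0`
(`shaCorank_eq_zero_of_forall`). Unconditional. [cite: Greenberg1999, §1 (coranks)] -/
theorem shaCorank_eq_zero_of_sha_inf_torsionBy_eq_bot {F : Type*} [Field F] [NumberField F]
    (W : WeierstrassCurve F) (p : ℕ) [Fact p.Prime] {n : ℕ} (hpn : p ∣ n)
    (h : W.sha ⊓ AddSubgroup.torsionBy W.galH1 (n : ℤ) = ⊥) : W.shaCorank p = 0 := by
  refine W.shaCorank_eq_zero_of_forall p fun c hc hpc ↦ ?_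
  obtain ⟨k, rfl⟩ := hpn
  have hnc : (p * k) • c = 0 := by rw [mul_nsmul, hpc, nsmul_zero]
  have hmem : c ∈ W.sha ⊓ AddSubgroup.torsionBy W.galH1 ((p * k : ℕ) : ℤ) :=
    AddSubgroup.mem_inf.mpr ⟨hc, AddSubgroup.torsionBy.nsmul_iff.mpr hnc⟩
  rw [h] at hmem
  exact (AddSubgroup.mem_bot).mp hmem

/-! ## The abstract twist-free door -/

/-- **The twist-free door from Kolyvagin's descent data.** `E/ℚ` elliptic, `K` a quadratic number
field with a non-trivial automorphism `c`, `p` an odd prime, `m = p`; `S` any instance of the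
minimal-depth descent data on `V = H¹(K, E[m])` (`KolyvaginDescent.HypothesesDepth`) whose Selmer
group is `Sel^(m)(E_K/K)`, whose involution is `conjAct W c m` and whose prime is `p`. If
`S.c n₁ ≠ 0` for a square-free product `n₁` of `S`-Kolyvagin primes with `ν₁` prime factors and
`ν₁ + 1 ≤ rank E(ℚ)`, then: `corank_{ℤ_p} Ш(E/ℚ)[p^∞] = 0`, `rank E(ℚ) = ν₁ + 1`,
`rank E^{(d_K)}(ℚ) ≤ ν₁`, `#E(ℚ)[p] = 1`, `Ш(E/ℚ)[p] = 0`, `#Sel_p(E/ℚ) = p^{ν₁+1}`. Proof: the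
eigen-bound `#Sel(E/K)_p^{+} ≤ p^{ν₁+1}` (`card_eigenSel_le_of_ne_zero`, Kolyvagin 1991 Thm. 2.3) is
read over `ℚ` through `Sel_p(E/ℚ) ↪ Sel_p(E/K)^+`
(`natCard_selmerGroup_le_of_forall_mem_of_finrank_eq_two`, file `SelmerTorsionRestriction`) and the
descent count over `ℚ` (`rank_and_sha_of_natCard_selmerGroup_le`); the total count
`#Sel(E/K)_p ≤ p^{2ν₁+1}` (`card_sel_le_of_ne_zero`) with `rank E(K) = rank E(ℚ) + rank E^{(d_K)}(ℚ)`
(`mordellWeilRank_baseChange_quadratic_holds`) bounds the twist. NO point on the twist is used.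
Conditional only on the data `S`; per-curve; BSD is not proved by it.
[cite: Kolyvagin1991MathAnn, Thm. 2.3] [cite: GrossLMS1991, §5 (5.1) and §10]
[cite: SilvermanAEC2009, Thm X.4.2 and Exercise 10.16] -/
theorem door_of_hypothesesDepth (W : WeierstrassCurve ℚ) [W.IsElliptic] (K : Type) [Field K]
    [NumberField K] (hK2 : Module.finrank ℚ K = 2) (c : K ≃ₐ[ℚ] K) (hc : c ≠ 1)
    (p : ℕ) [hp : Fact p.Prime] (hp2 : p ≠ 2) {m : ℕ} (hm : m = p) {Pl : Type*}
    (S : HypothesesDepth (galH1Torsion (W.baseChange K) (m : ℤ)) Pl)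
    (hSel : S.Sel = selmerGroup (W.baseChange K) (m : ℤ)) (hSp : S.p = p)
    (hSτ : S.τ = conjAct W c (m : ℤ))
    {n₁ : ℕ} (hn₁ : KolSupp S.Kol n₁) (hne : S.c n₁ ≠ 0)
    (hrank : n₁.primeFactors.card + 1 ≤ W.mordellWeilRank) :
    W.shaCorank p = 0 ∧ W.mordellWeilRank = n₁.primeFactors.card + 1 ∧
      (W.quadraticTwist (NumberField.discr K : ℚ)).mordellWeilRank ≤ n₁.primeFactors.card ∧
      Nat.card ↥(AddSubgroup.torsionBy W.toAffine.Point (m : ℤ)) = 1 ∧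
      W.sha ⊓ AddSubgroup.torsionBy W.galH1 (m : ℤ) = ⊥ ∧
      Nat.card ↥(selmerGroup W (m : ℤ)) = p ^ (n₁.primeFactors.card + 1) := by
  subst hm
  have hpP : m.Prime := hp.out
  set ν := n₁.primeFactors.card with hν
  -- Kolyvagin's eigen-bound at the `+1`-eigenspace
  obtain ⟨hfinE, hcardE⟩ := S.card_eigenSel_le_of_ne_zero hn₁ hne (e := 1) (Or.inl rfl)
  rw [hSp] at hcardE
  haveI := hfinE
  -- `Sel_p(E/ℚ) ↪ Sel_p(E/K)^+`
  have hT : ∀ s ∈ selmerGroup (W.baseChange K) (m : ℤ), conjAct W c (m : ℤ) s = (1 : ℤ) • s →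
      s ∈ S.eigenSel 1 := fun s hs hτ ↦ by
    rw [S.mem_eigenSel, hSel, hSτ]
    exact ⟨hs, hτ⟩
  obtain ⟨-, hcardQ⟩ := natCard_selmerGroup_le_of_forall_mem_of_finrank_eq_two K W c hK2 hc hpP
    hp2 (S.eigenSel 1) hT
  have hle : Nat.card ↥(selmerGroup W (m : ℤ)) ≤ m ^ (ν + 1) := hcardQ.trans hcardE
  -- the descent count over `ℚ`
  obtain ⟨hr, ht, hbot, hcardSel⟩ := rank_and_sha_of_natCard_selmerGroup_le W hpP.one_lt (ν + 1)
    hle hrank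
  have hsha : W.shaCorank m = 0 :=
    shaCorank_eq_zero_of_sha_inf_torsionBy_eq_bot W m (dvd_refl m) hbot
  -- the total count over `K` bounds the twist rank
  obtain ⟨hfinK, hcardK, -⟩ := S.card_sel_le_of_ne_zero hn₁ hne
  rw [hSp] at hcardK
  rw [hSel] at hfinK hcardK
  haveI hEK : (W.baseChange K).IsElliptic := by rw [WeierstrassCurve.baseChange]; infer_instance
  have hdK : (NumberField.discr K : ℚ) ≠ 0 := by exact_mod_cast NumberField.discr_ne_zero K
  haveI := W.isElliptic_quadraticTwist hdK
  set r' := (W.quadraticTwist (NumberField.discr K : ℚ)).mordellWeilRank with hr'_def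
  have hrk : (W.baseChange K).mordellWeilRank = W.mordellWeilRank + r' :=
    mordellWeilRank_baseChange_quadratic_holds W K hK2
  have hcountK := (W.baseChange K).natCard_selmerGroup_eq hpP.ne_zero
  set t' := Nat.card ↥(AddSubgroup.torsionBy (W.baseChange K).toAffine.Point (m : ℤ)) with ht'_def
  set u' := Nat.card ↥((W.baseChange K).sha ⊓ AddSubgroup.torsionBy (W.baseChange K).galH1 (m : ℤ))
    with hu'_def
  haveI := hfinK
  have hposK : 0 < Nat.card ↥(selmerGroup (W.baseChange K) (m : ℤ)) := Nat.card_pos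
  rw [hcountK, hrk] at hcardK hposK
  have ht0 : 0 < t' := Nat.pos_of_ne_zero fun h ↦ by
    rw [h, mul_zero, zero_mul] at hposK
    exact lt_irrefl 0 hposK
  have hu0 : 0 < u' := Nat.pos_of_ne_zero fun h ↦ by
    rw [h, mul_zero] at hposK
    exact lt_irrefl 0 hposK
  have hpow : m ^ (W.mordellWeilRank + r') ≤ m ^ (2 * ν + 1) := by
    calc m ^ (W.mordellWeilRank + r') ≤ m ^ (W.mordellWeilRank + r') * t' * u' := by
          rw [mul_assoc]
          exact Nat.le_mul_of_pos_right _ (Nat.mul_pos ht0 hu0)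
      _ ≤ m ^ (2 * ν + 1) := hcardK
  have hrr : W.mordellWeilRank + r' ≤ 2 * ν + 1 := (Nat.pow_le_pow_iff_right hpP.one_lt).mp hpow
  refine ⟨hsha, hr, ?_, by convert ht, hbot, hcardSel⟩
  omega

/-- **The crux's first rank clause from the twist-free door**: in the setting of
`door_of_hypothesesDepth`, `ν₁ + 1 = rank E(ℚ)` and `rank E^{(d_K)}(ℚ) < rank E(ℚ)` — the clause
`(n.primeFactors.card + 1 = W.mordellWeilRank ∧ (W.quadraticTwist d_K).mordellWeilRank <
W.mordellWeilRank)` of `KolyvaginDepthSupply`, read off WITHOUT a point on the twist.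
[cite: Kolyvagin1991MathAnn, Thm. 2.3] [cite: GrossLMS1991, §5 (5.1) and §10] -/
theorem kolyvaginDepthSupply_rankClause_of_hypothesesDepth (W : WeierstrassCurve ℚ) [W.IsElliptic]
    (K : Type) [Field K] [NumberField K] (hK2 : Module.finrank ℚ K = 2) (c : K ≃ₐ[ℚ] K) (hc : c ≠ 1)
    (p : ℕ) [Fact p.Prime] (hp2 : p ≠ 2) {m : ℕ} (hm : m = p) {Pl : Type*}
    (S : HypothesesDepth (galH1Torsion (W.baseChange K) (m : ℤ)) Pl)
    (hSel : S.Sel = selmerGroup (W.baseChange K) (m : ℤ)) (hSp : S.p = p)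
    (hSτ : S.τ = conjAct W c (m : ℤ))
    {n₁ : ℕ} (hn₁ : KolSupp S.Kol n₁) (hne : S.c n₁ ≠ 0)
    (hrank : n₁.primeFactors.card + 1 ≤ W.mordellWeilRank) :
    W.shaCorank p = 0 ∧
      (n₁.primeFactors.card + 1 = W.mordellWeilRank ∧
        (W.quadraticTwist (NumberField.discr K : ℚ)).mordellWeilRank < W.mordellWeilRank) := by
  obtain ⟨hsha, hr, hr', -⟩ := door_of_hypothesesDepth W K hK2 c hc p hp2 hm S hSel hSp hSτ hn₁ hne
    hrank
  exact ⟨hsha, hr.symm, by omega⟩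

/-! ## The leaves currency (Gross's Kolyvagin primes, a class family on `H¹(K, E[p])`) -/

/-- **The twist-free door from the leaves (first rank clause, any depth).** Setting of
`shaCorank_eq_zero_of_class_ne_zero_of_points_of_leaves` (file `…DoorOfLeaves`): `E/ℚ` elliptic
without CM, `K` imaginary quadratic with `d_K ∉ {−3, −4}` and the Heegner hypothesis for `N`, `P` a
Heegner point of level `N`, `p` odd with `ρ̄_{E,p}` onto, `c` the complex conjugation, a class family
`cl` with Gross's Props. 5.4 (2) and 6.2 (`hcl`), the §8 leaves `hB1`, `hB2`. If `cl n ≠ 0` at a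
square-free product `n` of Kolyvagin primes with `ν` prime factors and `ν + 1 ≤ rank E(ℚ)` — NO
hypothesis on the twist — then `corank_{ℤ_p} Ш(E/ℚ)[p^∞] = 0`, `rank E(ℚ) = ν + 1`,
`rank E^{(d_K)}(ℚ) ≤ ν`, `#E(ℚ)[p] = 1`, `Ш(E/ℚ)[p] = 0`, `#Sel_p(E/ℚ) = p^{ν+1}`
(`door_of_hypothesesDepth` on `exists_hypothesesDepth_of_leaves`). CONDITIONAL on `hB1`, `hB2`,
`hcl`; per-curve; BSD is not proved by it. [cite: Kolyvagin1991MathAnn, Thm. 2.3]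
[cite: GrossLMS1991, §5 (5.1), §10 with Props. 5.4, 6.2, 8.1, 8.2] -/
theorem shaCorank_eq_zero_of_class_ne_zero_of_rank_le_of_leaves
    {N : ℕ} [NeZero N] (W : WeierstrassCurve ℚ) [W.IsElliptic] (K : Type) [Field K]
    [NumberField K] (hB1 : Gross1991_prop_8_1_one N W K) (hB2 : Gross1991_prop_8_2_finset N W K)
    (hE : ¬ W.HasCM) (hK : IsImaginaryQuadratic K)
    (hD : NumberField.discr K ≠ -3 ∧ NumberField.discr K ≠ -4) (hH : SatisfiesHeegnerHypothesis N K)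
    {P : (W.baseChange K).toAffine.Point} (hP : IsHeegnerPoint N W K P) (p : ℕ) [hp : Fact p.Prime]
    (hp2 : p ≠ 2) (hρ : W.HasSurjectiveModNGaloisRep p) (c : K ≃ₐ[ℚ] K) (hc : c ≠ 1)
    (hcc : c * c = 1) (ε : ℤ) (hε : ε = 1 ∨ ε = -1) (cl : ℕ → galH1Torsion (W.baseChange K) p)
    (hcl : ∀ n : ℕ, Squarefree n → (∀ q ∈ n.primeFactors, IsKolyvaginPrime N W K p q) →
      conjAct W c p (cl n) = (ε * (-1) ^ n.primeFactors.card) • cl n ∧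
      (∀ v : HeightOneSpectrum (𝓞 K), (n : 𝓞 K) ∉ v.asIdeal →
        cl n ∈ selmerLocalKer (W.baseChange K) (v.adicCompletion K) p) ∧
      (∀ w : InfinitePlace K, cl n ∈ selmerLocalKer (W.baseChange K) w.Completion p) ∧
      (∀ ℓ : ℕ, ℓ.Prime → ℓ ∣ n → ∀ v : HeightOneSpectrum (𝓞 K), (ℓ : 𝓞 K) ∈ v.asIdeal →
        (cl n ∈ selmerLocalKer (W.baseChange K) (v.adicCompletion K) p ↔
          cl (n / ℓ) ∈ (W.baseChange K).torsionLocalKer (v.adicCompletion K) p)))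
    {n : ℕ} (hn : Squarefree n) (hkn : ∀ q ∈ n.primeFactors, IsKolyvaginPrime N W K p q)
    (hne : cl n ≠ 0) (hrank : n.primeFactors.card + 1 ≤ W.mordellWeilRank) :
    W.shaCorank p = 0 ∧ W.mordellWeilRank = n.primeFactors.card + 1 ∧
      (W.quadraticTwist (NumberField.discr K : ℚ)).mordellWeilRank ≤ n.primeFactors.card ∧
      Nat.card ↥(AddSubgroup.torsionBy W.toAffine.Point (p : ℤ)) = 1 ∧
      W.sha ⊓ AddSubgroup.torsionBy W.galH1 (p : ℤ) = ⊥ ∧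
      Nat.card ↥(selmerGroup W (p : ℤ)) = p ^ (n.primeFactors.card + 1) := by
  obtain ⟨S, hSel, hSp, hSc, hSK, hSτ⟩ := exists_hypothesesDepth_of_leaves hB1 hB2 hE hK hD hH hP
    hp.out hp2 hρ c hc hcc ε hε cl hcl
  have hsupp : KolSupp S.Kol n := by rw [hSK]; exact ⟨hn, hkn⟩
  have hne' : S.c n ≠ 0 := by rw [hSc]; exact hne
  exact door_of_hypothesesDepth W K hK.1 c hc p hp2 rfl S hSel hSp hSτ hsupp hne' hrank

/-- **The rank-2 slice without `hF` AND without a twist point — the depth-table row certificate from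
the leaves.** Same setting; ONE Kolyvagin prime `ℓ` with `cl ℓ ≠ 0` (the bit a depth table computes)
and two independent points on `E(ℚ)` give `corank_{ℤ_p} Ш(E/ℚ)[p^∞] = 0`, `rank E(ℚ) = 2`,
`rank E^{(d_K)}(ℚ) ≤ 1`, `E(ℚ)[p] = 0`, `Ш(E/ℚ)[p] = 0`, `#Sel_p(E/ℚ) = p²`. Compare g5's
`shaCorank_eq_zero_of_rank_two_of_class_prime_ne_zero_of_leaves`, which needs in addition
`1 ≤ rank E^{(d_K)}(ℚ)`. CONDITIONAL on `hB1`, `hB2`, `hcl`; per-curve; BSD is not proved by it.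
[cite: Kolyvagin1991MathAnn, Thm. 2.3] [cite: GrossLMS1991, §5 (5.1) and §10]
[cite: JetchevLauterStein2009, §3.6 (arXiv:0707.0032)] -/
theorem shaCorank_eq_zero_of_two_le_rank_of_class_prime_ne_zero_of_leaves
    {N : ℕ} [NeZero N] (W : WeierstrassCurve ℚ) [W.IsElliptic] (K : Type) [Field K]
    [NumberField K] (hB1 : Gross1991_prop_8_1_one N W K) (hB2 : Gross1991_prop_8_2_finset N W K)
    (hE : ¬ W.HasCM) (hK : IsImaginaryQuadratic K)
    (hD : NumberField.discr K ≠ -3 ∧ NumberField.discr K ≠ -4) (hH : SatisfiesHeegnerHypothesis N K)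
    {P : (W.baseChange K).toAffine.Point} (hP : IsHeegnerPoint N W K P) (p : ℕ) [hp : Fact p.Prime]
    (hp2 : p ≠ 2) (hρ : W.HasSurjectiveModNGaloisRep p) (c : K ≃ₐ[ℚ] K) (hc : c ≠ 1)
    (hcc : c * c = 1) (ε : ℤ) (hε : ε = 1 ∨ ε = -1) (cl : ℕ → galH1Torsion (W.baseChange K) p)
    (hcl : ∀ n : ℕ, Squarefree n → (∀ q ∈ n.primeFactors, IsKolyvaginPrime N W K p q) →
      conjAct W c p (cl n) = (ε * (-1) ^ n.primeFactors.card) • cl n ∧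
      (∀ v : HeightOneSpectrum (𝓞 K), (n : 𝓞 K) ∉ v.asIdeal →
        cl n ∈ selmerLocalKer (W.baseChange K) (v.adicCompletion K) p) ∧
      (∀ w : InfinitePlace K, cl n ∈ selmerLocalKer (W.baseChange K) w.Completion p) ∧
      (∀ ℓ : ℕ, ℓ.Prime → ℓ ∣ n → ∀ v : HeightOneSpectrum (𝓞 K), (ℓ : 𝓞 K) ∈ v.asIdeal →
        (cl n ∈ selmerLocalKer (W.baseChange K) (v.adicCompletion K) p ↔
          cl (n / ℓ) ∈ (W.baseChange K).torsionLocalKer (v.adicCompletion K) p)))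
    {ℓ : ℕ} (hℓ : IsKolyvaginPrime N W K p ℓ) (hne : cl ℓ ≠ 0) (h2 : 2 ≤ W.mordellWeilRank) :
    W.shaCorank p = 0 ∧ W.mordellWeilRank = 2 ∧
      (W.quadraticTwist (NumberField.discr K : ℚ)).mordellWeilRank ≤ 1 ∧
      Nat.card ↥(AddSubgroup.torsionBy W.toAffine.Point (p : ℤ)) = 1 ∧
      W.sha ⊓ AddSubgroup.torsionBy W.galH1 (p : ℤ) = ⊥ ∧
      Nat.card ↥(selmerGroup W (p : ℤ)) = p ^ 2 := by
  have hcard : ℓ.primeFactors.card = 1 := by rw [hℓ.prime.primeFactors, Finset.card_singleton]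
  have h := shaCorank_eq_zero_of_class_ne_zero_of_rank_le_of_leaves W K hB1 hB2 hE hK hD hH hP p hp2
    hρ c hc hcc ε hε cl hcl hℓ.prime.squarefree (fun q hq ↦ by
      rw [hℓ.prime.primeFactors, Finset.mem_singleton] at hq
      exact hq ▸ hℓ) hne (by rw [hcard]; exact h2)
  rw [hcard] at h
  exact h

end Summit.BirchSwinnertonDyer.BirchSwinnertonDyer.Theorems.KolyvaginDepthDoor

end
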